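import Literature.Computability.Complexity.EasyWitnessSearch
import Literature.Computability.Complexity.IKWGeneratorsProofs
import HarnessLib

/-!
# Discharges of named facts of `EasyWitness.lean`

`Literature/Computability/Complexity/EasyWitnessHolds.lean` — proofs-only sibling of
`EasyWitness.lean` (no definitions, no named facts). Each theorem below closes a named fact `X
: Prop` of that file as `X_holds : X` by composing an ACCEPTED reduction theorem of the tree
with the ACCEPTED unconditional `_holds` discharges of all of its hypotheses; nothing is
re-proved and no statement is changed. Recorded by the librarian sweep g25 (2026-08-16, pass
5c: facts dischargeable in one line from the tree's own lemmas), so that the facts census,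
`#h21_route_deps` and the cone guardrail see these facts as theorems.

Discharged here:

* `IKW2002_thm18_MA_holds` := `IKW2002_thm18_MA_of_thm12_2` `IKW2002_thm12_2_holds`
  (`EasyWitnessSearch.lean`).

## References

* [AroraBarakCC2009] — see `lean/references.bib` and the docstring of the fact in `EasyWitness.lean`.
* [ImpagliazzoKabanetsWigderson2002] — see `lean/references.bib` and the docstring of the fact in `EasyWitness.lean`.
-/

namespace Literature.Computability.Complexity

/-- **Discharge of the named fact `IKW2002_thm18_MA`** (`EasyWitness.lean`): IKW Theorem 18, `MA`
case: `NEXP ≠ EXP ⟹` for every `ε > 0`, `MA ⊆ io-[NTIME(2^{n^ε})/n^ε]`. Printed as Thm. … —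
obtained as `IKW2002_thm18_MA_of_thm12_2` applied to the tree's unconditional discharge
`IKW2002_thm12_2_holds` of its hypothesis (reduction in `EasyWitnessSearch.lean`).
[cite: ImpagliazzoKabanetsWigderson2002, Thm. 18 with Thm. 12 (2) and Lemma 17]
[cite: AroraBarakCC2009, proof of Lemma 20.20 (p. 417)] -/
theorem IKW2002_thm18_MA_holds :
    IKW2002_thm18_MA :=
  IKW2002_thm18_MA_of_thm12_2 IKW2002_thm12_2_holds

end Literature.Computability.Complexity
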